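import Summits.QuantumFields.YangMills.Theorems.BalabanUVNodesN16HolderDefs
import Summits.QuantumFields.YangMills.Theorems.BalabanUVNodesN16Shape
import HarnessLib

/-!
# Route «BalabanUVNodes», cluster K4 «SpineRates» — node N16 = NE3: THE ROW's DECL `T4EtaRateMin.NE3Shape` DOES NOT READ THE HÖLDER EXPONENT —
# `NE3EnergyRateWSup` and `NE3Shape` from the β-root `CovRootHolder … β` for EVERY `β` (n16-a g2's `…N16Shape` §2–§3 with `NE3EnergyRateWCov ↦ CovRootHolder · β`)

Cell `pub-ymgap`, seat `pub-ymgap-dag-n16-c` (R134 fan-out seat, strategy s1; HUMAN RULING D-0062; chair R424 venue), generation 3, file 17 — module (F) of the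
located item «the Hölder-exponent pin of N16's N05-socket» (`HOME/pub-ymgap-dag-n16-c/LOCATED-N16-HOLDER-PIN.md`); over file 11 `…N16HolderDefs` (`CovRootHolder`,
p478789) and n16-a's `…N16Shape` (p409765: `ne3EnergyRateWSup_of_cov`, `exists_ne3EnergyRateWSup_of_cov`, `ne3Shape_of_n16` — whose proofs DISCARD the third
covariant conjunct (Lip₂′ᶜ)).  Theorems only (0 `def`, 0 sorry).  `--supports stmt-QuantumFields-19908` (helper).  `bears_on: R4∕N16 · YM-PLAN §2 row N16 decl
`T4EtaRateMin.NE3Shape``.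

WHY (a located STRUCTURAL FACT for the R-β ruling).  N16 has two faces: the YM-PLAN row decl `T4EtaRateMin.NE3Shape` (action-rate + local-rate shape, reached by
n16-a's `ne3Shape_of_n16` from the covariant root) and the statement of record `N16At = NE3EnergyRateWCov …` whose (Lip₂′ᶜ) conjunct N19∕N21 read.  The located pin
(β₀ = 1) sits ONLY in (Lip₂′ᶜ).  n16-a's bridge `ne3EnergyRateWSup_of_cov` uses the energy conjunct and (Lip₁ᶜ) and DROPS (Lip₂′ᶜ) (`obtain ⟨…, hE, h1, -⟩`), so the
SAME proofs run from the β-root for ANY exponent `β`: THIS FILE types them.  Consequence: under R-β (N16's record re-worded at a printed `β₀ < 1`) the row's decl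
`NE3Shape` is reached from node N05's leaf AT ITS RESIDUAL EXPONENT with NO window condition (`n16_holder_of_b8LeafRS` ∘ `ne3Shape_of_covRootHolder`); the window
`β > 2∕3` concerns only the N19∕N21 consumers of (Lip₂′ᶜ) (`…N16HolderWindow`, n21-d `…N21HolderWidth`).

WHAT THIS FILE PROVES: §1 `ne3EnergyRateWSup_of_covRootHolder` · `exists_ne3EnergyRateWSup_of_covRootHolder` (T-E_w♯ from the β-root, any `β`; n16-a §2 token for
token); §2 `ne3Shape_of_covRootHolder` (n16-a's `ne3Shape_of_n16` with `h16 : CovRootHolder 4 (sfClass 4 L N ε) L N b (gradConst 4 c) C Λ₁ Λ₂' β dom`, any `β`; same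
proof); §3 `ne3Shape_of_n16HolderAt` (carriers form: `N16HolderAt c β` with `c.g = gradConst 4 c′` ⟹ the shape conclusion at `c`'s letters).
HONEST FRAMING: proof re-use over LANDED theorems by name; `CovRootHolder … β` (N05∕N07 content through THE END) and `LeafH3sup` are HYPOTHESES; nothing of
Bałaban's proved; **N16 ∕ NE3 NOT discharged**; count-neutral; one finite four-torus at fixed ε — NOT ℝ⁴, NOT infinite volume, NOT OS, NOT a mass gap, NOT Clay.
-/

set_option autoImplicit false

open scoped BigOperators Matrix Matrix.Norms.L2Operator
open NormedSpace Finset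

namespace Summit.QuantumFields.YangMills.BalabanUVNodes.N16HolderShape

open Literature.MathematicalPhysics.QuantumFieldTheory.Balaban1983to89
open B7Prop1Explicit B7Prop2Explicit
open T4AveragingDeficitWall hiding Site Plane Plaq Bond
open T4AveragingDeficitWallBoundary (IsPeriodicCfg periodBox)
open T4AveragingDeficitNonAbelian (wallConstNA wallConstNA_nonneg wallConstLoc)
open T4EtaRateMin (Readings ActionRate LocalRate NE3Shape)
open Summit.QuantumFields.BalabanUV.T4Continuum
open AveragingDeficitPeriodicCounting (IsPeriodicDir)
open AveragingDeficitDualResidual (dualC1 dualC2)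
open AveragingDeficitDerivWallProof (wallConst wallConst_nonneg)
open MinimalActionSandwich (IsMinimiser)
open MinimalActionRate (Regular sfClass minActReadings)
open MinimalActionRefine (RegularSup gradConst gradConst_nonneg)
open MinimalActionWitness (flatCfg)
open SkeletonPrecompGrad (gradRem)
open NE3EnergyShapes (residualScale IsUnitarySite IsPeriodicSite dualC1_nonneg dualC2_nonneg)
open NE3EnergyWeightedShapes (energyNormW)
open NE3EnergyWeightedCovShape (NE3EnergyRateWCov)
open NE3EnergyWeightedSupShape (NE3EnergyRateWSup)
open NE3.LeafIndexSockets (LeafH3sup)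
open NE3LocalCrudeWEnd (ne3Shape_crudeW_of_actionRate)
open MinimalActionThm1Type (actionRate_sfClass_thm1Type)
open NE3ShapeCrudeWitness (gradRem_four)
open NE7EtaRatesD4 (energy_budget_of_residualScale)
open NE7EtaRatesD4Cov (norm_dir_le_rate_cov)
open NE7EtaRatesD4CovReg (unitary_periodic_rescale_bavg_of_regular)
open NE7EtaBackgroundRefineThresholds (exists_regular_isMinimiser_thm1Type thresholds_four classRadius_four)
open NE7EtaBackgroundFlatStratum (gaugeAct_flatCfg_mem_sfClass)
open YMDAG.UVSplit (NE3Carriers)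
open Summit.QuantumFields.YangMills.BalabanUVNodes.N16HolderDefs (CovRootHolder N16HolderAt)
open Summit.QuantumFields.YangMills.BalabanUVNodes.N16 (thresholds45_four hmin_of_leafH3sup_four)

noncomputable section

variable {n : Type*} [Fintype n] [DecidableEq n]

/-! ## §1 T-E_w♯ from the β-root, any exponent -/

/-- **β-ROOT ⟹ T-E_w♯ WITH THE SAME PAIR `(u, Z)`, ANY EXPONENT `β`** (`d = 4`; letters as in n16-a's `N16.ne3EnergyRateWSup_of_cov`, whose proof this is token
for token — it reads the energy conjunct and (Lip₁ᶜ) and discards (Lip₂′ᶜ)): `CovRootHolder 4 𝒞 L N b g C Λ₁ Λ₂' β dom → NE3EnergyRateWSup 4 𝒞 L N b g C (8l₁²γ) dom`.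
[folklore] -/
theorem ne3EnergyRateWSup_of_covRootHolder [Nonempty n] {𝒞 : ℕ → Set (Site 4 → Fin 4 → (Matrix n n ℂ)ˣ)} {L N : ℕ} (hL : 2 ≤ L)
    (hN : 1 ≤ N) {b g C Λ₁ Λ₂' β : ℝ} (hb : 0 ≤ b) (hbs : 512 * (4 + 1) * (4 + 4) * (L : ℝ) ^ 2 * b ≤ 1) (hg : 0 ≤ g) (hC : 0 ≤ C)
    {dom : Set (Site 4 → Fin 4 → (Matrix n n ℂ)ˣ)} (hcov : CovRootHolder 4 𝒞 L N b g C Λ₁ Λ₂' β dom)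
    {γ l₁ : ℝ} (hγ : 0 < γ) (hγ3 : C * (wallConst 4 L * (N : ℝ) ^ 2 * (Real.sqrt g * dualC2 4 L + 2 * b ^ 2 * dualC1 4 L)) ≤ γ ^ 3)
    (hl₁ : 0 < l₁) (hΛl₁ : Λ₁ ≤ l₁ ^ 3) (hγl : γ ≤ l₁ * N) :
    NE3EnergyRateWSup 4 𝒞 L N b g C (8 * l₁ ^ 2 * γ) dom := by
  have hL1 : 1 ≤ L := by omega
  have hL0 : (0 : ℝ) < L := by exact_mod_cast (show 0 < L by omega)
  obtain ⟨θ, hθ, hθ6⟩ : ∃ θ : ℝ, 0 < θ ∧ θ ^ 6 = ((L : ℝ))⁻¹ :=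
    ⟨((L : ℝ)⁻¹) ^ ((1 : ℝ) / 6), Real.rpow_pos_of_pos (inv_pos.mpr hL0) _, by
      rw [← Real.rpow_natCast, ← Real.rpow_mul (inv_nonneg.mpr hL0.le)]; norm_num⟩
  have hθ1 : θ ≤ 1 := by
    have h : θ ^ 6 ≤ 1 := by rw [hθ6]; exact inv_le_one_of_one_le₀ (by exact_mod_cast hL1)
    exact (pow_le_one_iff_of_nonneg hθ.le (by norm_num)).mp h
  intro k hk V hV UA UB hA hB hreg
  obtain ⟨u, Z, hu, huP, hZ, hZP, hrep, hE, h1, -⟩ := hcov k hk V hV UA UB hA hB hreg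
  obtain ⟨hWu, hWP⟩ := unitary_periodic_rescale_bavg_of_regular hL1 hb hbs hreg
  have hEγ : (L : ℝ) ^ k * energyNormW L k (rescale L (bavg L UB)) Z (periodBox (d := 4) (N * L ^ k)) ≤ γ ^ 3 :=
    (energy_budget_of_residualScale hL1 N b hg hC k hE).trans hγ3
  have hfit : γ * (θ ^ k) ^ 2 ≤ l₁ * N := by
    have hθk : (θ ^ k) ^ 2 ≤ 1 := pow_le_one₀ (pow_nonneg hθ.le k) (pow_le_one₀ hθ.le hθ1)
    calc γ * (θ ^ k) ^ 2 ≤ γ * 1 := mul_le_mul_of_nonneg_left hθk hγ.le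
      _ ≤ l₁ * N := by rw [mul_one]; exact hγl
  refine ⟨u, Z, hu, huP, hZ, hZP, hrep, hE, fun x κ => ?_⟩
  have h := norm_dir_le_rate_cov hL hN hk hθ hθ6 hWu hWP hZP hγ hl₁ hΛl₁ hEγ h1 hfit x κ
  have h8 : θ ^ (8 * k) ≤ ((L : ℝ)⁻¹) ^ k := by
    rw [← hθ6, ← pow_mul]
    exact pow_le_pow_of_le_one hθ.le hθ1 (by omega)
  calc ‖Z x κ‖ ≤ 8 * l₁ ^ 2 * γ * θ ^ (8 * k) := h
    _ ≤ 8 * l₁ ^ 2 * γ * ((L : ℝ)⁻¹) ^ k := mul_le_mul_of_nonneg_left h8 (by positivity)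

/-- **β-ROOT ⟹ T-E_w♯, LETTER-FREE FORM, ANY EXPONENT `β`** — n16-a's `N16.exists_ne3EnergyRateWSup_of_cov` over §1. [folklore] -/
theorem exists_ne3EnergyRateWSup_of_covRootHolder [Nonempty n] {𝒞 : ℕ → Set (Site 4 → Fin 4 → (Matrix n n ℂ)ˣ)} {L N : ℕ} (hL : 2 ≤ L)
    (hN : 1 ≤ N) {b g C Λ₁ Λ₂' β : ℝ} (hb : 0 ≤ b) (hbs : 512 * (4 + 1) * (4 + 4) * (L : ℝ) ^ 2 * b ≤ 1) (hg : 0 ≤ g) (hC : 0 ≤ C)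
    {dom : Set (Site 4 → Fin 4 → (Matrix n n ℂ)ˣ)} (hcov : CovRootHolder 4 𝒞 L N b g C Λ₁ Λ₂' β dom) :
    ∃ s : ℝ, 0 ≤ s ∧ NE3EnergyRateWSup 4 𝒞 L N b g C s dom := by
  set ρ : ℝ := C * (wallConst 4 L * (N : ℝ) ^ 2 * (Real.sqrt g * dualC2 4 L + 2 * b ^ 2 * dualC1 4 L)) with hρ
  have hN1 : (1 : ℝ) ≤ N := by exact_mod_cast hN
  have hγ1 : 1 ≤ max 1 ρ := le_max_left _ _
  have hγ0 : 0 < max 1 ρ := lt_of_lt_of_le one_pos hγ1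
  have hγ3 : ρ ≤ max 1 ρ ^ 3 := (le_max_right _ _).trans (le_self_pow₀ hγ1 (by norm_num))
  have hl1 : 1 ≤ max 1 (max Λ₁ (max 1 ρ)) := le_max_left _ _
  have hl0 : 0 < max 1 (max Λ₁ (max 1 ρ)) := lt_of_lt_of_le one_pos hl1
  have hΛl : Λ₁ ≤ max 1 (max Λ₁ (max 1 ρ)) ^ 3 :=
    ((le_max_left _ _).trans (le_max_right _ _)).trans (le_self_pow₀ hl1 (by norm_num))
  have hγl : max 1 ρ ≤ max 1 (max Λ₁ (max 1 ρ)) * N := by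
    calc max 1 ρ ≤ max 1 (max Λ₁ (max 1 ρ)) := (le_max_right _ _).trans (le_max_right _ _)
      _ ≤ max 1 (max Λ₁ (max 1 ρ)) * N := le_mul_of_one_le_right hl0.le hN1
  exact ⟨8 * max 1 (max Λ₁ (max 1 ρ)) ^ 2 * max 1 ρ, by positivity,
    ne3EnergyRateWSup_of_covRootHolder hL hN hb hbs hg hC hcov hγ0 (by rw [← hρ]; exact hγ3) hl0 hΛl hγl⟩

/-! ## §2 The row's decl `NE3Shape` from the β-root and N07's interface, any exponent -/

/-- **N16 · THE ROW's DECL OF RECORD `T4EtaRateMin.NE3Shape` FROM THE β-ROOT ∧ N07's INTERFACE, FOR EVERY HÖLDER EXPONENT `β`** (`d = 4`; regime VERBATIM as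
in n16-a's `N16.ne3Shape_of_n16`, whose proof this is with `exists_ne3EnergyRateWSup_of_cov ↦ …_of_covRootHolder`): ASSUME `h16 : CovRootHolder 4 (sfClass 4 L N ε) L N
b (gradConst 4 c) C Λ₁ Λ₂' β dom` (= `N16HolderAt`'s body at `g = gradConst 4 c`) and `h3 : LeafH3sup 4 L N ε b c dom`.  THEN (a) a regular selection of minimisers
exists and (b) for every such selection `∃ C′ ≥ 0, NE3Shape (minActReadings … loc_D) C′ (L⁻¹)`.  So the row's decl is INSENSITIVE to the exponent of (Lip₂′ᶜ): under R-β
it is reached from node N05's leaf at its residual exponent (`N16HolderOfLeaf.n16_holder_of_b8LeafRS` ∘ this) with NO window condition.  N16 ∕ NE3 NOT proved: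
`h16` and `h3` are the hypotheses. [folklore] -/
theorem ne3Shape_of_covRootHolder [Nonempty n] {L N : ℕ} (hL : 2 ≤ L) (hN : 1 ≤ N) {ε ε₁ b c t C Λ₁ Λ₂' β : ℝ}
    (hb : 0 ≤ b) (hc : 0 ≤ c) (hbt : b ≤ t) (hct : c ≤ t) (hC : 0 ≤ C)
    (hsmall : (2 : ℝ) ^ 91 * (L : ℝ) ^ 17 * t ≤ 1) (hεt : (2 : ℝ) ^ 76 * (L : ℝ) ^ 12 * t ≤ ε)
    (hε1 : 16 * C0 4 * ε ≤ 3) (hε2 : 1024 * (4 + 1) * (4 + 4) * (L : ℝ) ^ 2 * ε ≤ 1)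
    (hε₁ : ε₁ ≤ 1 / 4) (hε₁b : ε₁ ≤ b) (hε₁c : 4 * ε₁ ≤ c)
    {dom : Set (Site 4 → Fin 4 → (Matrix n n ℂ)ˣ)} (hdom : dom ⊆ sfClass 4 L N ε₁ 0)
    (h16 : CovRootHolder 4 (sfClass 4 L N ε) L N b (gradConst 4 c) C Λ₁ Λ₂' β dom)
    (h3 : LeafH3sup 4 L N ε b c dom) :
    (∃ sel : ℕ → (Site 4 → Fin 4 → (Matrix n n ℂ)ˣ) → (Site 4 → Fin 4 → (Matrix n n ℂ)ˣ),
        ∀ V ∈ dom, ∀ k : ℕ, IsMinimiser 4 (sfClass 4 L N ε) L N k V (sel k V) ∧ RegularSup 4 L N b c k (sel k V)) ∧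
    ∀ sel : ℕ → (Site 4 → Fin 4 → (Matrix n n ℂ)ˣ) → (Site 4 → Fin 4 → (Matrix n n ℂ)ˣ),
      (∀ V ∈ dom, ∀ k : ℕ, IsMinimiser 4 (sfClass 4 L N ε) L N k V (sel k V)) →
      (∀ V ∈ dom, ∀ k : ℕ, RegularSup 4 L N b c k (sel k V)) →
      ∃ C' : ℝ, 0 ≤ C' ∧
        NE3Shape
          (minActReadings 4 (sfClass 4 L N ε) L N dom
            (fun k V (x : ↥(periodBox (d := 4) N)) =>
              fineAction (sel k V) (((blockSites L)^[k] {(x : Site 4)}) ×ˢ Finset.univ)))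
          C' ((L : ℝ)⁻¹) := by
  classical
  have hL1 : 1 ≤ L := le_trans (by norm_num) hL
  have ht0 : 0 ≤ t := hb.trans hbt
  have hmin := hmin_of_leafH3sup_four hL hb hc hbt hct hsmall hεt hε1 hε2 hε₁ hε₁b hε₁c hdom h3
  refine ⟨?_, fun sel hsel hreg => ?_⟩
  · -- (a) a regular selection by choice
    refine ⟨fun k V => if h : V ∈ dom then Classical.choose (hmin V h k) else V, fun V hV k => ?_⟩
    simp only [dif_pos hV]
    exact Classical.choose_spec (hmin V hV k)
  · -- (b) the thresholds of the action half at `d = 4`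
    obtain ⟨hT1, hT2, hT3⟩ := thresholds_four hL1 ht0 hsmall
    obtain ⟨hT4, hT5⟩ := thresholds45_four hL1 ht0 hsmall
    have hE := classRadius_four hL1 ht0 hεt
    -- the k-free averaging condition on `b` from threshold (ii): `52428800·L²·t ≤ 1`
    have hbs : 512 * (4 + 1) * (4 + 4) * (L : ℝ) ^ 2 * b ≤ 1 := by
      have e : (2 : ℝ) ^ 15 * (((4 : ℕ) : ℝ) + 1) ^ 2 * (((4 : ℕ) : ℝ) + 4) ^ 2 * (L : ℝ) ^ 2 * t = 52428800 * ((L : ℝ) ^ 2 * t) := by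
        push_cast; ring
      have h2 : 52428800 * ((L : ℝ) ^ 2 * t) ≤ 1 := by rw [← e]; exact hT2
      have hL2 : (0 : ℝ) ≤ (L : ℝ) ^ 2 := by positivity
      have h3' : (L : ℝ) ^ 2 * b ≤ (L : ℝ) ^ 2 * t := mul_le_mul_of_nonneg_left hbt hL2
      have h4 : 0 ≤ (L : ℝ) ^ 2 * b := mul_nonneg hL2 hb
      nlinarith
    have hbs' : 20480 * (L : ℝ) ^ 2 * b ≤ 1 := by convert hbs using 1; ring
    -- T-E_w♯ from N16's record (§2)
    obtain ⟨s, hs, hTE⟩ := exists_ne3EnergyRateWSup_of_covRootHolder hL hN hb hbs (gradConst_nonneg (d := 4) c) hC h16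
    -- the action half, route (A), for the (D)-reading of this selection
    have hA := actionRate_sfClass_thm1Type (d := 4) (n := n) (by norm_num) hL1 hN hb hc hbt hct hT1 hT2 hT3 hT4 hT5 hE hmin
      (fun k V (x : ↥(periodBox (d := 4) N)) => fineAction (sel k V) (((blockSites L)^[k] {(x : Site 4)}) ×ˢ Finset.univ))
    have hCA : 0 ≤ wallConstNA 4 L * (gradConst 4 1 + 1) / (L : ℝ) ^ 2 := by
      have := wallConstNA_nonneg (d := 4) L
      have := gradConst_nonneg (d := 4) (1 : ℝ)
      positivity
    exact ⟨_, le_trans hCA (le_max_left _ _), ne3Shape_crudeW_of_actionRate hL hN hb hc hC hs hbs' hTE hsel hreg hCA hA⟩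

/-! ## §3 Carriers form -/

/-- **`N16HolderAt c β` ∧ N07's INTERFACE ⟹ THE ROW's DECL AT THE BUNDLE's LETTERS, ANY `β`** (`c : NE3Carriers N` with regularity letter `c.g = gradConst 4 c′`
and the shape regime of §2 on `(c.ε, ε₁, c.b, c′, t, c.C)`): §2 at the bundle. [folklore] -/
theorem ne3Shape_of_n16HolderAt {N : ℕ} [NeZero N] (c : NE3Carriers N) {β ε₁ c' t : ℝ} (hL : 2 ≤ c.L) (hN : 1 ≤ c.Nper)
    (hb : 0 ≤ c.b) (hc : 0 ≤ c') (hbt : c.b ≤ t) (hct : c' ≤ t) (hC : 0 ≤ c.C) (hg : c.g = gradConst 4 c')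
    (hsmall : (2 : ℝ) ^ 91 * (c.L : ℝ) ^ 17 * t ≤ 1) (hεt : (2 : ℝ) ^ 76 * (c.L : ℝ) ^ 12 * t ≤ c.ε)
    (hε1 : 16 * C0 4 * c.ε ≤ 3) (hε2 : 1024 * (4 + 1) * (4 + 4) * (c.L : ℝ) ^ 2 * c.ε ≤ 1)
    (hε₁ : ε₁ ≤ 1 / 4) (hε₁b : ε₁ ≤ c.b) (hε₁c : 4 * ε₁ ≤ c')
    (hdom : c.dom ⊆ sfClass 4 c.L c.Nper ε₁ 0) (h16 : N16HolderAt c β) (h3 : LeafH3sup 4 c.L c.Nper c.ε c.b c' c.dom) :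
    (∃ sel : ℕ → (Site 4 → Fin 4 → (Matrix (Fin N) (Fin N) ℂ)ˣ) → (Site 4 → Fin 4 → (Matrix (Fin N) (Fin N) ℂ)ˣ),
        ∀ V ∈ c.dom, ∀ k : ℕ, IsMinimiser 4 (sfClass 4 c.L c.Nper c.ε) c.L c.Nper k V (sel k V) ∧ RegularSup 4 c.L c.Nper c.b c' k (sel k V)) ∧
    ∀ sel : ℕ → (Site 4 → Fin 4 → (Matrix (Fin N) (Fin N) ℂ)ˣ) → (Site 4 → Fin 4 → (Matrix (Fin N) (Fin N) ℂ)ˣ),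
      (∀ V ∈ c.dom, ∀ k : ℕ, IsMinimiser 4 (sfClass 4 c.L c.Nper c.ε) c.L c.Nper k V (sel k V)) →
      (∀ V ∈ c.dom, ∀ k : ℕ, RegularSup 4 c.L c.Nper c.b c' k (sel k V)) →
      ∃ C' : ℝ, 0 ≤ C' ∧
        NE3Shape
          (minActReadings 4 (sfClass 4 c.L c.Nper c.ε) c.L c.Nper c.dom
            (fun k V (x : ↥(periodBox (d := 4) c.Nper)) =>
              fineAction (sel k V) (((blockSites c.L)^[k] {(x : Site 4)}) ×ˢ Finset.univ)))
          C' ((c.L : ℝ)⁻¹) := by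
  haveI : Nonempty (Fin N) := ⟨⟨0, Nat.pos_of_ne_zero (NeZero.ne N)⟩⟩
  have h16' : CovRootHolder 4 (sfClass 4 c.L c.Nper c.ε) c.L c.Nper c.b (gradConst 4 c') c.C c.Λ₁ c.Λ₂' β c.dom := by
    have h := h16
    unfold N16HolderAt at h
    rw [hg] at h
    exact h
  exact ne3Shape_of_covRootHolder hL hN hb hc hbt hct hC hsmall hεt hε1 hε2 hε₁ hε₁b hε₁c hdom h16' h3

end

end Summit.QuantumFields.YangMills.BalabanUVNodes.N16HolderShape
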